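import Summits.QuantumAdvantage.QuantumAdvantage.Theorems.CubicForrelationNearExactIsExactTwelveBetaLabels
import Summits.QuantumAdvantage.QuantumAdvantage.Theorems.CubicForrelationNearExactIsExactTwelveLevelSixGammaH3
import Summits.QuantumAdvantage.QuantumAdvantage.Theorems.CubicForrelationNearExactIsExactTwelveWildParity
import Literature.Computability.QuantumComplexity.SimonFourier

/-!
# Crux `CubicForrelation.NearExactIsExact` (stmt-QuantumAdvantage-14043) — n = 12, configuration (β): the TRANSVERSAL 5-flat identity

Certificate seat `b2b-cforr-cert` (gen 25).  HONEST FRAMING: a finite-slice structure lemma (standard axioms) about cubic Boolean functions on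
12 bits — STEP 2 of the (β) × (β) kill at `Φ = 29/32` (HOME/b2b-cforr-cert-g25/PLAN-N12-928-BETA.md, "BREAKTHROUGH"); it claims NO value of
`θ₁₂`.  NOT summit progress.

Setting ((β), `g`-side): `W_g = 64u''`, `Z = {u'' even}`, `#Z = 768`, `e = u'' − (−1)^f` vanishes off `Z` and is a sign `(−1)^β` on `Z`;
`Z = ⊔ᵢ mᵢ ⊕ P` (`tbc_fibres`, `#P = 128`), no four labels dependent (`tbl_no_four`).

* `tbt_hyperplane`: `Z` lies in an affine hyperplane `{x : (−1)^{x·z₀} = t}` (`to15_weight768_in_hyperplane`) and some `u` has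
  `(−1)^{u·z₀} = −1`.
* `tbt_transversal`: (A) `r := m₁ ⊕ ⋯ ⊕ m₆ ∈ P`; (B) for all `v, t₁, …, t₄ ∈ P`:
  `β(m₁⊕v) ⊕ β(m₂⊕v⊕t₁) ⊕ β(m₃⊕v⊕t₂) ⊕ β(m₄⊕v⊕t₃) ⊕ β(m₅⊕v⊕t₄) ⊕ β(m₁⊕m₂⊕m₃⊕m₄⊕m₅⊕v⊕t₁⊕t₂⊕t₃⊕t₄) = 1`.
  Proof: the parametrised 5-flat with base `m₁ ⊕ v` and directions `u, d_j = m₁ ⊕ m_{j+1} ⊕ t_j` has residual sum `≡ 0 (mod 4)`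
  (`gh_flat5`); the `u`-translates leave the hyperplane, hence `Z`; of the sixteen remaining points exactly the six listed lie in `Z`
  (the others are `mᵢ ⊕ mⱼ ⊕ mₖ ⊕ P`, off `Z` by `tbl_no_four`), the last one iff `r ∈ P` — and five signs never sum to `0 mod 4`.

References: MacWilliams–Sloane (1977) Ch. 13 §3, Ch. 15; R. O'Donnell (2014) §1.4; D. Simon (1994) §3.1.  Axioms: the standard three.
-/

set_option linter.dupNamespace false -- D-0017: single-problem summit ⇒ `QuantumAdvantage.QuantumAdvantage` by design

noncomputable section

namespace Summit.QuantumAdvantage.QuantumAdvantage.Theorems.CubicForrelation.NearExactIsExact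

open Finset
open Literature.Computability.QuantumComplexity
open Literature.Computability.QuantumComplexity.BuzetChailloux (bxor zeroVec bxor_bxor_cancel_left bxor_zeroVec zeroVec_bxor bxor_comm
  bxor_self)
open Literature.Computability.QuantumComplexity.DerivativeWalsh (W)

/-- xor bookkeeping (one flat direction). [folklore] -/
theorem tbt_id1 (a w x r : Fin (6 + 6) → Bool) : bxor (bxor a w) (bxor (bxor a x) r) = bxor x (bxor w r) := by
  funext k; simp only [bxor]
  cases a k <;> cases w k <;> cases x k <;> cases r k <;> rfl

/-- xor bookkeeping (two flat directions). [folklore] -/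
theorem tbt_id2 (a w x r y s : Fin (6 + 6) → Bool) :
    bxor (bxor (bxor a w) (bxor (bxor a y) s)) (bxor (bxor a x) r) = bxor (bxor (bxor a x) y) (bxor (bxor w r) s) := by
  funext k; simp only [bxor]
  cases a k <;> cases w k <;> cases x k <;> cases r k <;> cases y k <;> cases s k <;> rfl

/-- xor bookkeeping (three flat directions). [folklore] -/
theorem tbt_id3 (a w x r y s z q : Fin (6 + 6) → Bool) :
    bxor (bxor (bxor (bxor a w) (bxor (bxor a z) q)) (bxor (bxor a y) s)) (bxor (bxor a x) r) =
      bxor (bxor (bxor x y) z) (bxor (bxor (bxor w r) s) q) := by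
  funext k; simp only [bxor]
  cases a k <;> cases w k <;> cases x k <;> cases r k <;> cases y k <;> cases s k <;> cases z k <;> cases q k <;> rfl

/-- xor bookkeeping (four flat directions). [folklore] -/
theorem tbt_id4 (a w z₁ q₁ z₂ q₂ z₃ q₃ z₄ q₄ : Fin (6 + 6) → Bool) :
    bxor (bxor (bxor (bxor (bxor a w) (bxor (bxor a z₄) q₄)) (bxor (bxor a z₃) q₃)) (bxor (bxor a z₂) q₂)) (bxor (bxor a z₁) q₁) =
      bxor (bxor (bxor (bxor (bxor a z₁) z₂) z₃) z₄) (bxor (bxor (bxor (bxor w q₁) q₂) q₃) q₄) := by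
  funext k; simp only [bxor]
  cases a k <;> cases w k <;> cases z₁ k <;> cases q₁ k <;> cases z₂ k <;> cases q₂ k <;> cases z₃ k <;> cases q₃ k <;> cases z₄ k <;> cases q₄ k <;> rfl

/-- xor bookkeeping (`P`-translation). [folklore] -/
theorem tbt_idT (m s p : Fin (6 + 6) → Bool) : bxor (bxor m (bxor s p)) p = bxor m s := by
  funext k; simp only [bxor]
  cases m k <;> cases s k <;> cases p k <;> rfl

/-- xor bookkeeping (`P`-translation of a triple). [folklore] -/
theorem tbt_idM (m a b c p : Fin (6 + 6) → Bool) :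
    bxor (bxor m (bxor (bxor (bxor a b) c) p)) p = bxor (bxor m a) (bxor b c) := by
  funext k; simp only [bxor]
  cases m k <;> cases a k <;> cases b k <;> cases c k <;> cases p k <;> rfl

/-- xor bookkeeping. [folklore] -/
theorem tbt_idb (a b c : Fin (6 + 6) → Bool) : bxor (bxor b a) (bxor b c) = bxor a c := by
  funext k; simp only [bxor]
  cases a k <;> cases b k <;> cases c k <;> rfl

/-- xor bookkeeping. [folklore] -/
theorem tbt_idc (a b c : Fin (6 + 6) → Bool) : bxor (bxor c a) (bxor b c) = bxor a b := by
  funext k; simp only [bxor]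
  cases a k <;> cases b k <;> cases c k <;> rfl

/-- xor bookkeeping (re-basing the last fibre). [folklore] -/
theorem tbt_idL (s m t : Fin (6 + 6) → Bool) : bxor s t = bxor m (bxor (bxor s m) t) := by
  funext k; simp only [bxor]
  cases s k <;> cases m k <;> cases t k <;> rfl

/-- xor bookkeeping (five-fold sums). [folklore] -/
theorem tbt_s1 (m₁ m₂ m₃ m₄ m₅ : Fin (6 + 6) → Bool) :
    bxor m₁ (bxor (bxor (bxor (bxor m₁ m₂) m₃) m₄) m₅) = bxor (bxor m₂ m₃) (bxor m₄ m₅) := by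
  funext k; simp only [bxor]
  cases m₁ k <;> cases m₂ k <;> cases m₃ k <;> cases m₄ k <;> cases m₅ k <;> rfl

/-- xor bookkeeping (five-fold sums). [folklore] -/
theorem tbt_s2 (m₁ m₂ m₃ m₄ m₅ : Fin (6 + 6) → Bool) :
    bxor m₂ (bxor (bxor (bxor (bxor m₁ m₂) m₃) m₄) m₅) = bxor (bxor m₁ m₃) (bxor m₄ m₅) := by
  funext k; simp only [bxor]
  cases m₁ k <;> cases m₂ k <;> cases m₃ k <;> cases m₄ k <;> cases m₅ k <;> rfl

/-- xor bookkeeping (five-fold sums). [folklore] -/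
theorem tbt_s3 (m₁ m₂ m₃ m₄ m₅ : Fin (6 + 6) → Bool) :
    bxor m₃ (bxor (bxor (bxor (bxor m₁ m₂) m₃) m₄) m₅) = bxor (bxor m₁ m₂) (bxor m₄ m₅) := by
  funext k; simp only [bxor]
  cases m₁ k <;> cases m₂ k <;> cases m₃ k <;> cases m₄ k <;> cases m₅ k <;> rfl

/-- xor bookkeeping (five-fold sums). [folklore] -/
theorem tbt_s4 (m₁ m₂ m₃ m₄ m₅ : Fin (6 + 6) → Bool) :
    bxor m₄ (bxor (bxor (bxor (bxor m₁ m₂) m₃) m₄) m₅) = bxor (bxor m₁ m₂) (bxor m₃ m₅) := by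
  funext k; simp only [bxor]
  cases m₁ k <;> cases m₂ k <;> cases m₃ k <;> cases m₄ k <;> cases m₅ k <;> rfl

/-- xor bookkeeping (five-fold sums). [folklore] -/
theorem tbt_s5 (m₁ m₂ m₃ m₄ m₅ : Fin (6 + 6) → Bool) :
    bxor m₅ (bxor (bxor (bxor (bxor m₁ m₂) m₃) m₄) m₅) = bxor (bxor m₁ m₂) (bxor m₃ m₄) := by
  funext k; simp only [bxor]
  cases m₁ k <;> cases m₂ k <;> cases m₃ k <;> cases m₄ k <;> cases m₅ k <;> rfl

/-- Six signs with sum `≡ 0 (mod 4)` contain an odd number of `−1`. [folklore] -/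
theorem tbt_six : ∀ b₁ b₂ b₃ b₄ b₅ b₆ : Bool, (4 : ℤ) ∣ sZ b₁ + sZ b₂ + sZ b₃ + sZ b₄ + sZ b₅ + sZ b₆ →
    (b₁ ^^ b₂ ^^ b₃ ^^ b₄ ^^ b₅ ^^ b₆) = true := by
  decide

/-- Five signs never sum to `0 mod 4`. [folklore] -/
theorem tbt_five : ∀ b₁ b₂ b₃ b₄ b₅ : Bool, ¬ (4 : ℤ) ∣ sZ b₁ + sZ b₂ + sZ b₃ + sZ b₄ + sZ b₅ := by
  decide

/-- **`Z` lies in an affine hyperplane, and some direction leaves it.**  For cubic `g` with `W_g = 64u''` and `#{u'' even} = 768`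
there are `z₀`, `u` and `t = ±1` with `(−1)^{x·z₀} = t` on `Z = {u'' even}` and `(−1)^{u·z₀} = −1`. [this work] -/
theorem tbt_hyperplane (g : (Fin (6 + 6) → Bool) → Bool) (hg : IsDegLeFun 3 g)
    (u'' : (Fin (6 + 6) → Bool) → ℤ) (hu'' : ∀ x, W (fun y => signOf (g y)) x = (2 : ℝ) ^ 6 * (u'' x : ℝ))
    (h768 : #(univ.filter fun x : Fin (6 + 6) → Bool => ¬ Odd (u'' x)) = 768) :
    ∃ (z₀ u : Fin (6 + 6) → Bool) (t : ℝ), (t = 1 ∨ t = -1) ∧ twist u z₀ = -1 ∧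
      ∀ x ∈ (univ.filter fun x : Fin (6 + 6) → Bool => ¬ Odd (u'' x)), twist x z₀ = t := by
  classical
  have hp : IsDegLeFun 3 (fun x => decide (Odd (u'' x))) :=
    stub_walshTower stub_axParity (6 + 6) 6 3 g u'' hg hu'' (by intro k hk hkn; omega)
  have hp' : IsDegLeFun 3 (fun x => decide (Odd (u'' x)) ^^ true) := tb_isDegLeFun_xor_const hp true
  have hfilt : (univ.filter fun x : Fin (6 + 6) → Bool => (decide (Odd (u'' x)) ^^ true) = true) =
      (univ.filter fun x : Fin (6 + 6) → Bool => ¬ Odd (u'' x)) :=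
    filter_congr fun x _ => by simp
  obtain ⟨z₀, t, hz₀, ht, hhyp⟩ := to15_weight768_in_hyperplane _ hp' (by rw [hfilt, h768])
  have hex : ∃ i, z₀ i = true := by
    by_contra h
    exact hz₀ (funext fun i => by simpa [zeroVec] using fun hi => h ⟨i, hi⟩)
  obtain ⟨i, hi⟩ := hex
  refine ⟨z₀, fun j => decide (j = i), t, ht, ?_, fun x hx => hhyp x ?_⟩
  · rw [twist, Finset.prod_eq_single i]
    · simp [hi]
    · intro l _ hl; simp [hl]
    · intro h; exact absurd (mem_univ i) h
  · have hx' := (mem_filter.1 hx).2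
    simpa using hx'
set_option maxHeartbeats 400000 in
/-- **The transversal 5-flat identity** (module docstring): under the (β) hypotheses on the `g`-side, with six fibre representatives
`m₁, …, m₆` of `Z = {u'' even}` (`tbc_fibres`) and `e = (−1)^β` on `Z`: (A) `m₁ ⊕ ⋯ ⊕ m₆ ∈ P`, and (B) the six-point sign identity
for every `v, t₁, …, t₄ ∈ P`. [this work] -/
theorem tbt_transversal (f g : (Fin (6 + 6) → Bool) → Bool) (hf : IsDegLeFun 3 f) (hg : IsDegLeFun 3 g)
    (u'' : (Fin (6 + 6) → Bool) → ℤ) (hu'' : ∀ x, W (fun y => signOf (g y)) x = (2 : ℝ) ^ 6 * (u'' x : ℝ))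
    (h768 : #(univ.filter fun x : Fin (6 + 6) → Bool => ¬ Odd (u'' x)) = 768)
    (β : (Fin (6 + 6) → Bool) → Bool)
    (hβ : ∀ x ∈ (univ.filter fun x : Fin (6 + 6) → Bool => ¬ Odd (u'' x)), u'' x - sZ (f x) = sZ (β x))
    (hoff0 : ∀ y, y ∉ (univ.filter fun x : Fin (6 + 6) → Bool => ¬ Odd (u'' x)) → u'' y - sZ (f y) = 0)
    (m₁ m₂ m₃ m₄ m₅ m₆ : Fin (6 + 6) → Bool)
    (hm₁ : m₁ ∈ (univ.filter fun x : Fin (6 + 6) → Bool => ¬ Odd (u'' x)))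
    (hm₂ : m₂ ∈ (univ.filter fun x : Fin (6 + 6) → Bool => ¬ Odd (u'' x)))
    (hm₃ : m₃ ∈ (univ.filter fun x : Fin (6 + 6) → Bool => ¬ Odd (u'' x)))
    (hm₄ : m₄ ∈ (univ.filter fun x : Fin (6 + 6) → Bool => ¬ Odd (u'' x)))
    (hm₅ : m₅ ∈ (univ.filter fun x : Fin (6 + 6) → Bool => ¬ Odd (u'' x)))
    (hm₆ : m₆ ∈ (univ.filter fun x : Fin (6 + 6) → Bool => ¬ Odd (u'' x)))
    (hdist : ∀ a b, (a, b) ∈ [(m₁, m₂), (m₁, m₃), (m₁, m₄), (m₁, m₅), (m₁, m₆), (m₂, m₃), (m₂, m₄), (m₂, m₅), (m₂, m₆), (m₃, m₄),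
      (m₃, m₅), (m₃, m₆), (m₄, m₅), (m₄, m₆), (m₅, m₆)] →
      bxor a b ∉ (univ.filter fun a : Fin (6 + 6) → Bool => ∀ x, decide (Odd (u'' (bxor x a))) = decide (Odd (u'' x))))
    (hcov : ∀ x ∈ (univ.filter fun x : Fin (6 + 6) → Bool => ¬ Odd (u'' x)),
      bxor m₁ x ∈ (univ.filter fun a : Fin (6 + 6) → Bool => ∀ x, decide (Odd (u'' (bxor x a))) = decide (Odd (u'' x))) ∨
      bxor m₂ x ∈ (univ.filter fun a : Fin (6 + 6) → Bool => ∀ x, decide (Odd (u'' (bxor x a))) = decide (Odd (u'' x))) ∨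
      bxor m₃ x ∈ (univ.filter fun a : Fin (6 + 6) → Bool => ∀ x, decide (Odd (u'' (bxor x a))) = decide (Odd (u'' x))) ∨
      bxor m₄ x ∈ (univ.filter fun a : Fin (6 + 6) → Bool => ∀ x, decide (Odd (u'' (bxor x a))) = decide (Odd (u'' x))) ∨
      bxor m₅ x ∈ (univ.filter fun a : Fin (6 + 6) → Bool => ∀ x, decide (Odd (u'' (bxor x a))) = decide (Odd (u'' x))) ∨
      bxor m₆ x ∈ (univ.filter fun a : Fin (6 + 6) → Bool => ∀ x, decide (Odd (u'' (bxor x a))) = decide (Odd (u'' x)))) :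
    bxor (bxor (bxor (bxor (bxor m₁ m₂) m₃) m₄) m₅) m₆ ∈
      (univ.filter fun a : Fin (6 + 6) → Bool => ∀ x, decide (Odd (u'' (bxor x a))) = decide (Odd (u'' x))) ∧
    ∀ v ∈ (univ.filter fun a : Fin (6 + 6) → Bool => ∀ x, decide (Odd (u'' (bxor x a))) = decide (Odd (u'' x))),
    ∀ t₁ ∈ (univ.filter fun a : Fin (6 + 6) → Bool => ∀ x, decide (Odd (u'' (bxor x a))) = decide (Odd (u'' x))),
    ∀ t₂ ∈ (univ.filter fun a : Fin (6 + 6) → Bool => ∀ x, decide (Odd (u'' (bxor x a))) = decide (Odd (u'' x))),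
    ∀ t₃ ∈ (univ.filter fun a : Fin (6 + 6) → Bool => ∀ x, decide (Odd (u'' (bxor x a))) = decide (Odd (u'' x))),
    ∀ t₄ ∈ (univ.filter fun a : Fin (6 + 6) → Bool => ∀ x, decide (Odd (u'' (bxor x a))) = decide (Odd (u'' x))),
      (β (bxor m₁ v) ^^ β (bxor m₂ (bxor v t₁)) ^^ β (bxor m₃ (bxor v t₂)) ^^ β (bxor m₄ (bxor v t₃)) ^^ β (bxor m₅ (bxor v t₄)) ^^
        β (bxor (bxor (bxor (bxor (bxor m₁ m₂) m₃) m₄) m₅) (bxor (bxor (bxor (bxor v t₁) t₂) t₃) t₄))) = true := by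
  classical
  set Z := (univ.filter fun x : Fin (6 + 6) → Bool => ¬ Odd (u'' x)) with hZdef
  set P := (univ.filter fun a : Fin (6 + 6) → Bool => ∀ x, decide (Odd (u'' (bxor x a))) = decide (Odd (u'' x))) with hPdef
  set e : (Fin (6 + 6) → Bool) → ℤ := fun x => u'' x - sZ (f x) with hedef
  have hβ' : ∀ x ∈ Z, e x = sZ (β x) := hβ
  have hoff0' : ∀ y, y ∉ Z → e y = 0 := hoff0
  have hP0 : zeroVec ∈ P := tbc_P_zero u''
  have hPadd : ∀ a ∈ P, ∀ b ∈ P, bxor a b ∈ P := tbc_P_add u''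
  have hZst : ∀ x ∈ Z, ∀ a ∈ P, bxor x a ∈ Z := fun x hx a ha => tbc_Z_stable u'' hx ha
  -- the six representatives as a set
  set M := ({m₁, m₂, m₃, m₄, m₅, m₆} : Finset (Fin (6 + 6) → Bool)) with hMdef
  obtain ⟨hM6, hpairM⟩ := tbl_six_set u'' m₁ m₂ m₃ m₄ m₅ m₆ hdist
  have i₁ : m₁ ∈ M := by simp [hMdef]
  have i₂ : m₂ ∈ M := by simp [hMdef]
  have i₃ : m₃ ∈ M := by simp [hMdef]
  have i₄ : m₄ ∈ M := by simp [hMdef]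
  have i₅ : m₅ ∈ M := by simp [hMdef]
  have i₆ : m₆ ∈ M := by simp [hMdef]
  have hMZ : ∀ a ∈ M, a ∈ Z := by
    intro a ha
    simp only [hMdef, mem_insert, mem_singleton] at ha
    rcases ha with rfl | rfl | rfl | rfl | rfl | rfl <;> assumption
  have hcovM : ∀ x ∈ Z, ∃ a ∈ M, bxor a x ∈ P := by
    intro x hx
    rcases hcov x hx with h | h | h | h | h | h
    · exact ⟨m₁, i₁, h⟩
    · exact ⟨m₂, i₂, h⟩
    · exact ⟨m₃, i₃, h⟩
    · exact ⟨m₄, i₄, h⟩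
    · exact ⟨m₅, i₅, h⟩
    · exact ⟨m₆, i₆, h⟩
  have hne : ∀ a b, bxor a b ∉ P → a ≠ b := by
    rintro a b h rfl; rw [bxor_self] at h; exact h hP0
  have n12 := hne _ _ (hdist m₁ m₂ (by simp)); have n13 := hne _ _ (hdist m₁ m₃ (by simp))
  have n14 := hne _ _ (hdist m₁ m₄ (by simp)); have n15 := hne _ _ (hdist m₁ m₅ (by simp))
  have n23 := hne _ _ (hdist m₂ m₃ (by simp)); have n24 := hne _ _ (hdist m₂ m₄ (by simp))
  have n25 := hne _ _ (hdist m₂ m₅ (by simp)); have n34 := hne _ _ (hdist m₃ m₄ (by simp))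
  have n35 := hne _ _ (hdist m₃ m₅ (by simp)); have n45 := hne _ _ (hdist m₄ m₅ (by simp))
  have d56 := hdist m₅ m₆ (by simp)
  -- no four labels dependent (`tbl_no_four`), and its consequences off `Z`
  have NF : ∀ {a b c d : Fin (6 + 6) → Bool}, a ∈ M → b ∈ M → c ∈ M → d ∈ M → a ≠ b → a ≠ c → a ≠ d → b ≠ c → b ≠ d → c ≠ d →
      bxor (bxor a b) (bxor c d) ∉ P :=
    fun ha hb hc hd => tbl_no_four g hg u'' hu'' h768 M hM6 hMZ hpairM hcovM ha hb hc hd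
  have T3 : ∀ {a b c : Fin (6 + 6) → Bool}, a ∈ M → b ∈ M → c ∈ M → a ≠ b → a ≠ c → b ≠ c →
      ∀ p ∈ P, bxor (bxor (bxor a b) c) p ∉ Z := by
    intro a b c ha hb hc hab hac hbc p hp hx
    obtain ⟨m, hm, hmx⟩ := hcovM _ hx
    have h4 : bxor (bxor m a) (bxor b c) ∈ P := by
      have := hPadd _ hmx _ hp; rwa [tbt_idM] at this
    by_cases hma : m = a
    · subst hma; rw [bxor_self, zeroVec_bxor] at h4; exact hpairM _ hb _ hc hbc h4
    by_cases hmb : m = b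
    · subst hmb; rw [tbt_idb] at h4; exact hpairM _ ha _ hc hac h4
    by_cases hmc : m = c
    · subst hmc; rw [tbt_idc] at h4; exact hpairM _ ha _ hb hab h4
    · exact NF hm ha hb hc hma hmb hmc hab hac hbc h4
  have T5 : bxor (bxor (bxor (bxor (bxor m₁ m₂) m₃) m₄) m₅) m₆ ∉ P → ∀ p ∈ P, bxor (bxor (bxor (bxor (bxor m₁ m₂) m₃) m₄) m₅) p ∉ Z := by
    intro hr p hp hx
    obtain ⟨m, hm, hmx⟩ := hcovM _ hx
    have h5 : bxor m (bxor (bxor (bxor (bxor m₁ m₂) m₃) m₄) m₅) ∈ P := by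
      have := hPadd _ hmx _ hp; rwa [tbt_idT] at this
    simp only [hMdef, mem_insert, mem_singleton] at hm
    rcases hm with rfl | rfl | rfl | rfl | rfl | rfl
    · rw [tbt_s1] at h5; exact NF i₂ i₃ i₄ i₅ n23 n24 n25 n34 n35 n45 h5
    · rw [tbt_s2] at h5; exact NF i₁ i₃ i₄ i₅ n13 n14 n15 n34 n35 n45 h5
    · rw [tbt_s3] at h5; exact NF i₁ i₂ i₄ i₅ n12 n14 n15 n24 n25 n45 h5
    · rw [tbt_s4] at h5; exact NF i₁ i₂ i₃ i₅ n12 n13 n15 n23 n25 n35 h5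
    · rw [tbt_s5] at h5; exact NF i₁ i₂ i₃ i₄ n12 n13 n14 n23 n24 n34 h5
    · rw [bxor_comm] at h5; exact hr h5
  -- the hyperplane containing `Z`, and a direction `u` leaving it
  obtain ⟨z₀, u, t, ht, hu, hZt⟩ := tbt_hyperplane g hg u'' hu'' h768
  have txl : ∀ x y : Fin (6 + 6) → Bool, twist (bxor x y) z₀ = twist x z₀ * twist y z₀ := fun x y => Simon.twist_xor_left x y z₀
  have htt : t * t = 1 := by rcases ht with rfl | rfl <;> norm_num
  have ht0 : t ≠ 0 := by rcases ht with rfl | rfl <;> norm_num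
  have hPt : ∀ p ∈ P, twist p z₀ = 1 := by
    intro p hp
    have h1 := hZt _ (hZst _ hm₁ _ hp)
    rw [txl, hZt _ hm₁] at h1
    rcases Simon.twist_eq_one_or p z₀ with h | h
    · exact h
    · exfalso; rw [h] at h1; apply ht0; linarith
  have hoffZ : ∀ x, twist x z₀ = -t → x ∉ Z := by
    intro x hx hxZ; rw [hZt x hxZ] at hx; apply ht0; linarith
  -- the 5-flat computation
  have main : ∀ v ∈ P, ∀ t₁ ∈ P, ∀ t₂ ∈ P, ∀ t₃ ∈ P, ∀ t₄ ∈ P,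
      (4 : ℤ) ∣ e (bxor m₁ v) + e (bxor m₂ (bxor v t₁)) + e (bxor m₃ (bxor v t₂)) + e (bxor m₄ (bxor v t₃)) + e (bxor m₅ (bxor v t₄)) +
        e (bxor (bxor (bxor (bxor (bxor m₁ m₂) m₃) m₄) m₅) (bxor (bxor (bxor (bxor v t₁) t₂) t₃) t₄)) := by
    intro v hv t₁ ht₁ t₂ ht₂ t₃ ht₃ t₄ ht₄
    obtain ⟨B, hB⟩ : ∃ B : Fin (6 + 6) → Bool, B = bxor m₁ v := ⟨_, rfl⟩
    obtain ⟨D₁, hD₁⟩ : ∃ D : Fin (6 + 6) → Bool, D = bxor (bxor m₁ m₂) t₁ := ⟨_, rfl⟩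
    obtain ⟨D₂, hD₂⟩ : ∃ D : Fin (6 + 6) → Bool, D = bxor (bxor m₁ m₃) t₂ := ⟨_, rfl⟩
    obtain ⟨D₃, hD₃⟩ : ∃ D : Fin (6 + 6) → Bool, D = bxor (bxor m₁ m₄) t₃ := ⟨_, rfl⟩
    obtain ⟨D₄, hD₄⟩ : ∃ D : Fin (6 + 6) → Bool, D = bxor (bxor m₁ m₅) t₄ := ⟨_, rfl⟩
    have h5 : (4 : ℤ) ∣ ∑ ε : Fin 5 → Bool, e (fun j => B j ^^ decide (Odd #(univ.filter fun i =>
        ε i && (![u, D₁, D₂, D₃, D₄] : Fin 5 → Fin (6 + 6) → Bool) i j))) := gh_flat5 f g hf hg u'' hu'' B ![u, D₁, D₂, D₃, D₄]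
    rw [fr_sum_peel e B u ![D₁, D₂, D₃, D₄]] at h5
    -- the `u`-translates leave the hyperplane
    set V₀ := (univ.filter fun d : Fin (6 + 6) → Bool => twist d z₀ = 1) with hV₀
    have hV0 : zeroVec ∈ V₀ := mem_filter.2 ⟨mem_univ _, by simp [twist, zeroVec]⟩
    have hQ : ∀ x : Fin (6 + 6) → Bool, twist x z₀ = t → ∀ a ∈ V₀, twist (bxor x a) z₀ = t := fun x hx a ha => by
      rw [txl, hx, (mem_filter.1 ha).2, mul_one]
    have hBt : twist B z₀ = t := by rw [hB, txl, hZt _ hm₁, hPt _ hv, mul_one]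
    have mkV : ∀ m t', m ∈ Z → t' ∈ P → bxor (bxor m₁ m) t' ∈ V₀ := fun m t' hm ht' =>
      mem_filter.2 ⟨mem_univ _, by rw [txl, txl, hZt _ hm₁, hZt _ hm, hPt _ ht', htt, one_mul]⟩
    have hVD₁ : D₁ ∈ V₀ := hD₁ ▸ mkV m₂ t₁ hm₂ ht₁
    have hVD₂ : D₂ ∈ V₀ := hD₂ ▸ mkV m₃ t₂ hm₃ ht₂
    have hVD₃ : D₃ ∈ V₀ := hD₃ ▸ mkV m₄ t₃ hm₄ ht₃
    have hVD₄ : D₄ ∈ V₀ := hD₄ ▸ mkV m₅ t₄ hm₅ ht₄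
    have hDs : ∀ i, (![D₁, D₂, D₃, D₄] : Fin 4 → Fin (6 + 6) → Bool) i ∈ V₀ := by
      intro i; fin_cases i <;> assumption
    have hflat : ∀ ε : Fin 4 → Bool, twist (fun j => B j ^^ decide (Odd #(univ.filter fun i =>
        ε i && (![D₁, D₂, D₃, D₄] : Fin 4 → Fin (6 + 6) → Bool) i j))) z₀ = t :=
      ws_flatPt_mem V₀ hV0 (fun x => twist x z₀ = t) hQ 4 B hBt ![D₁, D₂, D₃, D₄] hDs
    have hz : ∑ ε : Fin 4 → Bool, e (bxor (fun j => B j ^^ decide (Odd #(univ.filter fun i =>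
        ε i && (![D₁, D₂, D₃, D₄] : Fin 4 → Fin (6 + 6) → Bool) i j))) u) = 0 :=
      sum_eq_zero fun ε _ => hoff0' _ (hoffZ _ (by rw [txl, hflat ε, hu, mul_neg_one]))
    rw [hz, add_zero, fr_sum4] at h5
    -- the sixteen points: ten lie off `Z`
    have z4 : e (bxor (bxor B D₂) D₁) = 0 := by
      rw [hB, hD₁, hD₂, tbt_id2]
      exact hoff0' _ (T3 i₁ i₂ i₃ n12 n13 n23 _ (hPadd _ (hPadd _ hv _ ht₁) _ ht₂))
    have z6 : e (bxor (bxor B D₃) D₁) = 0 := by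
      rw [hB, hD₁, hD₃, tbt_id2]
      exact hoff0' _ (T3 i₁ i₂ i₄ n12 n14 n24 _ (hPadd _ (hPadd _ hv _ ht₁) _ ht₃))
    have z7 : e (bxor (bxor B D₃) D₂) = 0 := by
      rw [hB, hD₂, hD₃, tbt_id2]
      exact hoff0' _ (T3 i₁ i₃ i₄ n13 n14 n34 _ (hPadd _ (hPadd _ hv _ ht₂) _ ht₃))
    have z8 : e (bxor (bxor (bxor B D₃) D₂) D₁) = 0 := by
      rw [hB, hD₁, hD₂, hD₃, tbt_id3]
      exact hoff0' _ (T3 i₂ i₃ i₄ n23 n24 n34 _ (hPadd _ (hPadd _ (hPadd _ hv _ ht₁) _ ht₂) _ ht₃))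
    have z10 : e (bxor (bxor B D₄) D₁) = 0 := by
      rw [hB, hD₁, hD₄, tbt_id2]
      exact hoff0' _ (T3 i₁ i₂ i₅ n12 n15 n25 _ (hPadd _ (hPadd _ hv _ ht₁) _ ht₄))
    have z11 : e (bxor (bxor B D₄) D₂) = 0 := by
      rw [hB, hD₂, hD₄, tbt_id2]
      exact hoff0' _ (T3 i₁ i₃ i₅ n13 n15 n35 _ (hPadd _ (hPadd _ hv _ ht₂) _ ht₄))
    have z12 : e (bxor (bxor (bxor B D₄) D₂) D₁) = 0 := by
      rw [hB, hD₁, hD₂, hD₄, tbt_id3]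
      exact hoff0' _ (T3 i₂ i₃ i₅ n23 n25 n35 _ (hPadd _ (hPadd _ (hPadd _ hv _ ht₁) _ ht₂) _ ht₄))
    have z13 : e (bxor (bxor B D₄) D₃) = 0 := by
      rw [hB, hD₃, hD₄, tbt_id2]
      exact hoff0' _ (T3 i₁ i₄ i₅ n14 n15 n45 _ (hPadd _ (hPadd _ hv _ ht₃) _ ht₄))
    have z14 : e (bxor (bxor (bxor B D₄) D₃) D₁) = 0 := by
      rw [hB, hD₁, hD₃, hD₄, tbt_id3]
      exact hoff0' _ (T3 i₂ i₄ i₅ n24 n25 n45 _ (hPadd _ (hPadd _ (hPadd _ hv _ ht₁) _ ht₃) _ ht₄))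
    have z15 : e (bxor (bxor (bxor B D₄) D₃) D₂) = 0 := by
      rw [hB, hD₂, hD₃, hD₄, tbt_id3]
      exact hoff0' _ (T3 i₃ i₄ i₅ n34 n35 n45 _ (hPadd _ (hPadd _ (hPadd _ hv _ ht₂) _ ht₃) _ ht₄))
    -- the six points in (or conditionally in) `Z`
    have k2 : e (bxor B D₁) = e (bxor m₂ (bxor v t₁)) := by
      rw [hB, hD₁, tbt_id1]
    have k3 : e (bxor B D₂) = e (bxor m₃ (bxor v t₂)) := by
      rw [hB, hD₂, tbt_id1]
    have k5 : e (bxor B D₃) = e (bxor m₄ (bxor v t₃)) := by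
      rw [hB, hD₃, tbt_id1]
    have k9 : e (bxor B D₄) = e (bxor m₅ (bxor v t₄)) := by
      rw [hB, hD₄, tbt_id1]
    have k16 : e (bxor (bxor (bxor (bxor B D₄) D₃) D₂) D₁) = e (bxor (bxor (bxor (bxor (bxor m₁ m₂) m₃) m₄) m₅) (bxor (bxor (bxor (bxor v t₁) t₂) t₃) t₄)) := by
      rw [hB, hD₁, hD₂, hD₃, hD₄, tbt_id4]
    rw [z4, z6, z7, z8, z10, z11, z12, z13, z14, z15, k2, k3, k5, k9, k16, hB] at h5
    simpa only [add_zero] using h5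
  -- (A): `r ∈ P`, else five signs would sum to `0 mod 4`
  have hA : bxor (bxor (bxor (bxor (bxor m₁ m₂) m₃) m₄) m₅) m₆ ∈ P := by
    by_contra hr
    have h := main zeroVec hP0 zeroVec hP0 zeroVec hP0 zeroVec hP0 zeroVec hP0
    simp only [bxor_zeroVec] at h
    have hS : e (bxor (bxor (bxor (bxor m₁ m₂) m₃) m₄) m₅) = 0 := hoff0' _ (by simpa only [bxor_zeroVec] using T5 hr zeroVec hP0)
    rw [hS, add_zero, hβ' _ hm₁, hβ' _ hm₂, hβ' _ hm₃, hβ' _ hm₄, hβ' _ hm₅] at h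
    exact tbt_five _ _ _ _ _ h
  refine ⟨hA, fun v hv t₁ ht₁ t₂ ht₂ t₃ ht₃ t₄ ht₄ => ?_⟩
  have h := main v hv t₁ ht₁ t₂ ht₂ t₃ ht₃ t₄ ht₄
  have hT : (bxor (bxor (bxor (bxor v t₁) t₂) t₃) t₄) ∈ P := hPadd _ (hPadd _ (hPadd _ (hPadd _ hv _ ht₁) _ ht₂) _ ht₃) _ ht₄
  have hlast : bxor (bxor (bxor (bxor (bxor m₁ m₂) m₃) m₄) m₅) (bxor (bxor (bxor (bxor v t₁) t₂) t₃) t₄) ∈ Z := by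
    rw [tbt_idL (bxor (bxor (bxor (bxor m₁ m₂) m₃) m₄) m₅) m₆]
    exact hZst _ hm₆ _ (hPadd _ hA _ hT)
  rw [hβ' _ (hZst _ hm₁ _ hv), hβ' _ (hZst _ hm₂ _ (hPadd _ hv _ ht₁)), hβ' _ (hZst _ hm₃ _ (hPadd _ hv _ ht₂)),
    hβ' _ (hZst _ hm₄ _ (hPadd _ hv _ ht₃)), hβ' _ (hZst _ hm₅ _ (hPadd _ hv _ ht₄)), hβ' _ hlast] at h
  exact tbt_six _ _ _ _ _ _ h

end Summit.QuantumAdvantage.QuantumAdvantage.Theorems.CubicForrelation.NearExactIsExact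

end
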